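import Literature.NumberTheory.EllipticCurves.ShintaniConeGaussSums
import HarnessLib

/-!
# Genus symbols on the level-`32` lattice `[32a, 64b, c]`: the genus character of `-8D`

[[cite: Shintani1975, §2 (2.1), Thm. 2 (characters `χ` on `L/NL`)]] — arithmetic of the lattice
`L₃₂ = {ι₃₂(v) = [32v₀, 64v₁, v₂] = 32v₀X² + 64v₁XY + v₂Y² : v ∈ ℤ³}` of binary quadratic forms, the
`N = 32` member of Shintani's family `[Na, b, c] ⊇ {2N ∣ b}` (the tree's `ShintaniGenusSymbols` is
the `N = 64` member), which is the lattice whose twisted theta kernels lift the LEVEL-`32`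
congruent-number newform `φ` into Tunnell's space `S_{3/2}(128, 1)` (route to
`Literature.NumberTheory.EllipticCurves.Tunnell1983_a_sq_propto_L_one`; the level-`64` kernels
only see the `Γ₀(32)`-symmetrisation of `φ`'s integrand and produce forms of level `64`, i.e.
multiples of `Θ′` — numerically established in the seat's notes — so the `N = 32` lattice is needed):

* `nQ32 v = 32v₁² - v₀v₂` (`disc ι₃₂(v) = 128 nQ32 v`), its polar form, the right action
  `actInt32 a b c' d` of `g = (a b; 32c' d) ∈ Γ₀(32)` in coordinates (`nQ32_actInt32`: invariance);
* `coneSym32 p v` — the local genus symbol at an odd prime `p`: `0` unless `p ∣ nQ32 v`, then the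
  Legendre symbol of the unit square class of VALUES of `ι₃₂(v)`: `(2v₀/p)` (the value `32v₀` at
  `(1,0)`, `32 = 2·4²`) or, if `p ∣ v₀`, `(v₂/p)`;
* `genusWt32 D v = χ₈(v₂) · χ₋₄(v₂)^{[D ≡ 1 (4)]} · ∏_{p ∣ D} coneSym32 p v` — the genus character
  of the discriminant `-8D` (its `2`-adic component is `χ₋₈` for `D ≡ 1 (mod 4)`, `χ₈` for
  `D ≡ 3 (mod 4)`), the weight of the `D`-th twisted kernel on `L₃₂`; it is ODD in `v` for every
  odd `D` (`genusWt32_neg`), which is what the weight-`3/2` Schwartz function needs.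

PROVED: `|ω| ≤ 1`; `ω(v) = 0` unless `D ∣ nQ32 v`; periodicity modulo `M` with `8 ∣ M`, `D ∣ M`;
oddness; **`Γ₀(32)`-invariance** (`genusWt32_actInt32`, cone lemmas A/B with `32` in place of
`64`); the scaling law `ω(tv) = χ₈(t) χ₋₄(t)^{[D≡1(4)]} (t/D) ω(v)` (`genusWt32_smul`).
No named facts; definitions `nQ32`, `bQ32`, `actInt32`, `actEquiv32`, `coneSym32`, `twoWt`,
`genusWt32`, `binVal32`.
-/

namespace Literature.NumberTheory.EllipticCurves.Shintani

/-! ### The reduced discriminant on `L₃₂` -/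

/-- `n₃₂(v) = 32 v₁² - v₀ v₂` (`disc ι₃₂(v) = 128 n₃₂(v)`). [folklore] -/
def nQ32 (v : Fin 3 → ℤ) : ℤ := 32 * v 1 ^ 2 - v 0 * v 2

/-- Its polar form `B(v, u) = 64 v₁u₁ - v₀u₂ - v₂u₀`. [folklore] -/
def bQ32 (v u : Fin 3 → ℤ) : ℤ := 64 * v 1 * u 1 - v 0 * u 2 - v 2 * u 0

/-- `nQ32_add` (auxiliary). [folklore] -/
theorem nQ32_add (v u : Fin 3 → ℤ) : nQ32 (v + u) = nQ32 v + bQ32 v u + nQ32 u := by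
  simp only [nQ32, bQ32, Pi.add_apply]; ring

/-- `nQ32_neg` (auxiliary). [folklore] -/
theorem nQ32_neg (v : Fin 3 → ℤ) : nQ32 (-v) = nQ32 v := by
  simp only [nQ32, Pi.neg_apply]; ring

/-- `nQ32_smul` (auxiliary). [folklore] -/
theorem nQ32_smul (t : ℤ) (v : Fin 3 → ℤ) : nQ32 (t • v) = t ^ 2 * nQ32 v := by
  simp only [nQ32, Pi.smul_apply, smul_eq_mul]; ring

/-! ### The action of `Γ₀(32)` on `L₃₂` in coordinates -/

/-- For `g = (a b; 32c' d)`: coordinates of `ι₃₂(v) ∘ g` in `L₃₂`, where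
`(x ∘ g)(X, Y) = x(aX + bY, 32c'X + dY)`. [folklore] -/
def actInt32 (a b c' d : ℤ) (v : Fin 3 → ℤ) : Fin 3 → ℤ :=
  ![v 0 * a ^ 2 + 64 * v 1 * a * c' + 32 * v 2 * c' ^ 2,
    v 0 * a * b + v 1 * (a * d + 32 * b * c') + v 2 * c' * d,
    32 * v 0 * b ^ 2 + 64 * v 1 * b * d + v 2 * d ^ 2]

/-- `actInt32_zero` (auxiliary). [folklore] -/
@[simp] theorem actInt32_zero (a b c' d : ℤ) (v : Fin 3 → ℤ) :
    actInt32 a b c' d v 0 = v 0 * a ^ 2 + 64 * v 1 * a * c' + 32 * v 2 * c' ^ 2 := rfl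
/-- `actInt32_one` (auxiliary). [folklore] -/
@[simp] theorem actInt32_one (a b c' d : ℤ) (v : Fin 3 → ℤ) :
    actInt32 a b c' d v 1 = v 0 * a * b + v 1 * (a * d + 32 * b * c') + v 2 * c' * d := rfl
/-- `actInt32_two` (auxiliary). [folklore] -/
@[simp] theorem actInt32_two (a b c' d : ℤ) (v : Fin 3 → ℤ) :
    actInt32 a b c' d v 2 = 32 * v 0 * b ^ 2 + 64 * v 1 * b * d + v 2 * d ^ 2 := rfl

/-- `n₃₂(ι(v) ∘ g) = (det g)² n₃₂(v)`. [folklore] -/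
theorem nQ32_actInt32_eq (a b c' d : ℤ) (v : Fin 3 → ℤ) :
    nQ32 (actInt32 a b c' d v) = (a * d - 32 * b * c') ^ 2 * nQ32 v := by
  simp only [nQ32, actInt32_zero, actInt32_one, actInt32_two]; ring

/-- `n₃₂` is invariant when `ad - 32bc' = 1`. [folklore] -/
theorem nQ32_actInt32 {a b c' d : ℤ} (hdet : a * d - 32 * b * c' = 1) (v : Fin 3 → ℤ) :
    nQ32 (actInt32 a b c' d v) = nQ32 v := by
  rw [nQ32_actInt32_eq, hdet, one_pow, one_mul]

/-- Composition of the coordinate actions. [folklore] -/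
theorem actInt32_actInt32 (a b c' d a₁ b₁ c₁' d₁ : ℤ) (v : Fin 3 → ℤ) :
    actInt32 a b c' d (actInt32 a₁ b₁ c₁' d₁ v) =
      actInt32 (a₁ * a + 32 * b₁ * c') (a₁ * b + b₁ * d) (c₁' * a + d₁ * c') (32 * c₁' * b + d₁ * d) v := by
  funext i
  fin_cases i <;> simp [actInt32] <;> ring

/-- The identity acts trivially. [folklore] -/
theorem actInt32_one_zero (v : Fin 3 → ℤ) : actInt32 1 0 0 1 v = v := by
  funext i
  fin_cases i <;> simp [actInt32]

/-- `v ↦ actInt32 g v` is a bijection of `ℤ³` for `g = (a b; 32c' d)` of determinant `1`. [folklore] -/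
def actEquiv32 (a b c' d : ℤ) (hdet : a * d - 32 * b * c' = 1) : (Fin 3 → ℤ) ≃ (Fin 3 → ℤ) where
  toFun := actInt32 a b c' d
  invFun := actInt32 d (-b) (-c') a
  left_inv v := by
    rw [actInt32_actInt32]
    have e1 : a * d + 32 * b * -c' = 1 := by linear_combination hdet
    have e2 : a * -b + b * a = 0 := by ring
    have e3 : c' * d + d * -c' = 0 := by ring
    have e4 : 32 * c' * -b + d * a = 1 := by linear_combination hdet
    rw [e1, e2, e3, e4, actInt32_one_zero]
  right_inv v := by
    rw [actInt32_actInt32]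
    have e1 : d * a + 32 * -b * c' = 1 := by linear_combination hdet
    have e2 : d * b + -b * d = 0 := by ring
    have e3 : -c' * a + a * c' = 0 := by ring
    have e4 : 32 * -c' * b + a * d = 1 := by linear_combination hdet
    rw [e1, e2, e3, e4, actInt32_one_zero]

/-- `actEquiv32_apply` (auxiliary). [folklore] -/
@[simp] theorem actEquiv32_apply (a b c' d : ℤ) (hdet : a * d - 32 * b * c' = 1) (v : Fin 3 → ℤ) :
    actEquiv32 a b c' d hdet v = actInt32 a b c' d v := rfl

/-! ### The local genus symbols and the weight -/

/-- **The local genus symbol on `L₃₂`** at an odd prime `p`: `0` unless `p ∣ n₃₂(v)`, and then the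
Legendre symbol of the unit square class of values of `ι₃₂(v) = [32v₀, 64v₁, v₂]`, read off from the
value `32v₀` at `(1,0)` (`(32v₀/p) = (2v₀/p)`) or, if `p ∣ v₀`, from the value `v₂` at `(0,1)`.
[cite: Shintani1975, §2 (characters `χ` on `L/NL`)] -/
def coneSym32 (p : ℕ) (v : Fin 3 → ℤ) : ℤ :=
  if (p : ℤ) ∣ nQ32 v then (if (p : ℤ) ∣ v 0 then jacobiSym (v 2) p else jacobiSym (2 * v 0) p) else 0

/-- The `2`-adic component: `χ₈(v₂) χ₋₄(v₂)` for `D ≡ 1 (mod 4)` (`= χ₋₈(v₂)`), `χ₈(v₂)` otherwise;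
as an integer-valued function of `v₂`. [folklore] -/
def twoWt (D : ℕ) (c : ℤ) : ℤ :=
  (ZMod.χ₈ c : ℤ) * (if D % 4 = 1 then (ZMod.χ₄ c : ℤ) else 1)

/-- **The weight `ω_D` on `L₃₂`** (`D` odd square-free): the genus character of the discriminant
`-8D` on the forms `ι₃₂(v)` with `D ∣ n₃₂(v)`. [cite: Shintani1975, Thm. 2 (`v = χ(x₁)`)] -/
def genusWt32 (D : ℕ) (v : Fin 3 → ℤ) : ℤ :=
  twoWt D (v 2) * ∏ p ∈ D.primeFactors, coneSym32 p v

/-- `coneSym32_of_not_dvd` (auxiliary). [folklore] -/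
theorem coneSym32_of_not_dvd {p : ℕ} {v : Fin 3 → ℤ} (h : ¬ (p : ℤ) ∣ nQ32 v) : coneSym32 p v = 0 := by
  simp [coneSym32, h]

/-- `abs_coneSym32_le` (auxiliary). [folklore] -/
theorem abs_coneSym32_le (p : ℕ) (v : Fin 3 → ℤ) : |coneSym32 p v| ≤ 1 := by
  unfold coneSym32
  split_ifs
  · exact abs_jacobiSym_le _ _
  · exact abs_jacobiSym_le _ _
  · simp

/-- `|χ₈(n)| ≤ 1`. [folklore] -/
theorem abs_χ₈_le (n : ℤ) : |(ZMod.χ₈ n : ℤ)| ≤ 1 := by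
  rw [ZMod.χ₈_int_eq_if_mod_eight]
  split_ifs <;> simp

/-- `|twoWt D c| ≤ 1`. [folklore] -/
theorem abs_twoWt_le (D : ℕ) (c : ℤ) : |twoWt D c| ≤ 1 := by
  unfold twoWt
  rw [abs_mul]
  have h1 := abs_χ₈_le c
  have h2 : |(if D % 4 = 1 then (ZMod.χ₄ c : ℤ) else 1)| ≤ 1 := by
    split_ifs
    · exact abs_χ₄_le c
    · simp
  have h0 : 0 ≤ |(if D % 4 = 1 then (ZMod.χ₄ c : ℤ) else 1)| := abs_nonneg _
  nlinarith [abs_nonneg ((ZMod.χ₈ c : ℤ))]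

/-- `abs_genusWt32_le` (auxiliary). [folklore] -/
theorem abs_genusWt32_le (D : ℕ) (v : Fin 3 → ℤ) : |genusWt32 D v| ≤ 1 := by
  unfold genusWt32
  rw [abs_mul, Finset.abs_prod]
  have h1 := abs_twoWt_le D (v 2)
  have h2 : ∏ p ∈ D.primeFactors, |coneSym32 p v| ≤ 1 :=
    Finset.prod_le_one (fun _ _ ↦ abs_nonneg _) (fun p _ ↦ abs_coneSym32_le p v)
  have h3 : (0 : ℤ) ≤ ∏ p ∈ D.primeFactors, |coneSym32 p v| := Finset.prod_nonneg fun _ _ ↦ abs_nonneg _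
  nlinarith [abs_nonneg (twoWt D (v 2))]

/-- `ω_D(v) = 0` unless `D ∣ n₃₂(v)` (`D` square-free). [folklore] -/
theorem genusWt32_of_not_dvd {D : ℕ} (hD : Squarefree D) {v : Fin 3 → ℤ} (h : ¬ (D : ℤ) ∣ nQ32 v) :
    genusWt32 D v = 0 := by
  unfold genusWt32
  by_contra hne
  apply h
  apply natCast_dvd_of_primeFactors_dvd hD
  intro p hp
  by_contra hpn
  exact hne (by rw [Finset.prod_eq_zero hp (coneSym32_of_not_dvd hpn), mul_zero])

/-! #### Periodicity -/

/-- `n₃₂` respects congruences. [folklore] -/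
theorem nQ32_emod_congr {M : ℤ} {v u : Fin 3 → ℤ} (h : ∀ i, v i ≡ u i [ZMOD M]) :
    nQ32 v ≡ nQ32 u [ZMOD M] := by
  unfold nQ32
  have h0 := h 0; have h1 := h 1; have h2 := h 2
  exact ((h1.pow 2).mul_left 32).sub (h0.mul h2)

/-- `coneSym32_congr` (auxiliary). [folklore] -/
theorem coneSym32_congr {p : ℕ} {M : ℤ} (hpM : (p : ℤ) ∣ M) {v u : Fin 3 → ℤ}
    (h : ∀ i, v i ≡ u i [ZMOD M]) : coneSym32 p v = coneSym32 p u := by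
  have h' : ∀ i, v i ≡ u i [ZMOD p] := fun i ↦ (h i).of_dvd hpM
  have hn : nQ32 v ≡ nQ32 u [ZMOD p] := nQ32_emod_congr h'
  have e1 : ((p : ℤ) ∣ nQ32 v) ↔ ((p : ℤ) ∣ nQ32 u) := by
    rw [Int.dvd_iff_emod_eq_zero, Int.dvd_iff_emod_eq_zero, hn]
  have e2 : ((p : ℤ) ∣ v 0) ↔ ((p : ℤ) ∣ u 0) := by
    rw [Int.dvd_iff_emod_eq_zero, Int.dvd_iff_emod_eq_zero, h' 0]
  have h20 : 2 * v 0 ≡ 2 * u 0 [ZMOD p] := (h' 0).mul_left 2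
  unfold coneSym32
  rw [jacobiSym.mod_left' (h' 2), jacobiSym.mod_left' h20]
  by_cases hv : (p : ℤ) ∣ nQ32 v
  · rw [if_pos hv, if_pos (e1.mp hv)]
    by_cases hv0 : (p : ℤ) ∣ v 0
    · rw [if_pos hv0, if_pos (e2.mp hv0)]
    · rw [if_neg hv0, if_neg (mt e2.mpr hv0)]
  · rw [if_neg hv, if_neg (mt e1.mpr hv)]

/-- `χ₈_congr` (auxiliary): `χ₈` depends on `a mod M` when `8 ∣ M`. [folklore] -/
theorem χ₈_congr {M : ℤ} (h8 : (8 : ℤ) ∣ M) {a b : ℤ} (h : a ≡ b [ZMOD M]) :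
    ZMod.χ₈ a = ZMod.χ₈ b := by
  have h' : a ≡ b [ZMOD 8] := h.of_dvd h8
  rw [ZMod.χ₈_int_mod_eight a, ZMod.χ₈_int_mod_eight b, h']

/-- `twoWt_congr` (auxiliary). [folklore] -/
theorem twoWt_congr (D : ℕ) {M : ℤ} (h8 : (8 : ℤ) ∣ M) {a b : ℤ} (h : a ≡ b [ZMOD M]) :
    twoWt D a = twoWt D b := by
  unfold twoWt
  rw [χ₈_congr h8 h, χ₄_congr (dvd_trans (by norm_num) h8) h]

/-- **Periodicity**: `ω_D` depends on `v` only modulo `M` whenever `8 ∣ M` and `D ∣ M`. [folklore] -/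
theorem genusWt32_congr {D : ℕ} {M : ℤ} (h8 : (8 : ℤ) ∣ M) (hDM : (D : ℤ) ∣ M) {v u : Fin 3 → ℤ}
    (h : ∀ i, v i ≡ u i [ZMOD M]) : genusWt32 D v = genusWt32 D u := by
  unfold genusWt32
  rw [twoWt_congr D h8 (h 2)]
  congr 1
  refine Finset.prod_congr rfl fun p hp ↦ coneSym32_congr ?_ h
  exact dvd_trans (Int.natCast_dvd_natCast.mpr (Nat.dvd_of_mem_primeFactors hp)) hDM

/-! #### Oddness -/

/-- `Ω_p(-v) = χ₄(p) Ω_p(v)`. [folklore] -/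
theorem coneSym32_neg {p : ℕ} (hp : Odd p) (v : Fin 3 → ℤ) :
    coneSym32 p (-v) = ZMod.χ₄ p * coneSym32 p v := by
  unfold coneSym32
  rw [nQ32_neg]
  simp only [Pi.neg_apply, dvd_neg]
  split_ifs
  · exact jacobiSym.neg _ hp
  · rw [show (2 : ℤ) * -v 0 = -(2 * v 0) by ring]; exact jacobiSym.neg _ hp
  · simp

/-- `χ₈(-c) = χ₈(c)` and `χ₄(-c) = -χ₄(c)`: the `2`-adic weight satisfies
`twoWt D (-c) = -twoWt D c` for `D ≡ 1 (mod 4)` and `= twoWt D c` otherwise. [folklore] -/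
theorem twoWt_neg (D : ℕ) (c : ℤ) :
    twoWt D (-c) = (if D % 4 = 1 then -1 else 1) * twoWt D c := by
  unfold twoWt
  have h8 : (ZMod.χ₈ ((-c : ℤ) : ZMod 8) : ℤ) = ZMod.χ₈ ((c : ℤ) : ZMod 8) := by
    rw [Int.cast_neg, neg_eq_neg_one_mul, map_mul]
    have : (ZMod.χ₈ (-1 : ZMod 8) : ℤ) = 1 := by decide
    rw [this, one_mul]
  have h4 : (ZMod.χ₄ ((-c : ℤ) : ZMod 4) : ℤ) = -ZMod.χ₄ ((c : ℤ) : ZMod 4) := by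
    rw [Int.cast_neg, neg_eq_neg_one_mul, map_mul]
    have : (ZMod.χ₄ (-1 : ZMod 4) : ℤ) = -1 := by decide
    rw [this]; ring
  rw [h8]
  split_ifs <;> [rw [h4]; skip] <;> ring

/-- **Oddness of the weight**: `ω_D(-v) = -ω_D(v)` for every odd square-free `D`. [folklore] -/
theorem genusWt32_neg {D : ℕ} (hD : Squarefree D) (hDodd : Odd D) (v : Fin 3 → ℤ) :
    genusWt32 D (-v) = -genusWt32 D v := by
  unfold genusWt32
  have hodd : ∀ p ∈ D.primeFactors, Odd p := fun p hp ↦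
    hDodd.of_dvd_nat (Nat.dvd_of_mem_primeFactors hp)
  rw [Finset.prod_congr rfl fun p hp ↦ coneSym32_neg (hodd p hp) v, Finset.prod_mul_distrib,
    prod_χ₄_primeFactors hD, Pi.neg_apply, twoWt_neg]
  rcases Nat.odd_mod_four_iff.mp (Nat.odd_iff.mp hDodd) with h1 | h3
  · have : (ZMod.χ₄ (D : ZMod 4) : ℤ) = 1 := by rw [ZMod.χ₄_nat_mod_four, h1]; decide
    rw [if_pos h1, this]; ring
  · have : (ZMod.χ₄ (D : ZMod 4) : ℤ) = -1 := by rw [ZMod.χ₄_nat_mod_four, h3]; decide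
    rw [if_neg (by omega), this]; ring

/-! #### Invariance of `Ω_p` under `Γ₀(32)` (the cone `ι₃₂(v) ≡ λ ℓ² (mod p)`) -/

/-- Values of the binary form: `ι₃₂(v)(s, t) = 32 v₀ s² + 64 v₁ s t + v₂ t²`. [folklore] -/
def binVal32 (v : Fin 3 → ℤ) (s t : ℤ) : ℤ := 32 * v 0 * s ^ 2 + 64 * v 1 * s * t + v 2 * t ^ 2

/-- Completing the square: `32 v₀ · ι₃₂(v)(s,t) = (32 v₀ s + 32 v₁ t)² - 32 n₃₂(v) t²`. [folklore] -/
theorem mul_binVal32_eq (v : Fin 3 → ℤ) (s t : ℤ) :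
    32 * v 0 * binVal32 v s t = (32 * v 0 * s + 32 * v 1 * t) ^ 2 - 32 * nQ32 v * t ^ 2 := by
  simp only [binVal32, nQ32]; ring

/-- `actInt32_zero_eq` (auxiliary). [folklore] -/
theorem actInt32_zero_eq (a b c' d : ℤ) (v : Fin 3 → ℤ) :
    32 * actInt32 a b c' d v 0 = binVal32 v a (32 * c') := by
  simp only [actInt32_zero, binVal32]; ring

/-- `actInt32_two_eq` (auxiliary). [folklore] -/
theorem actInt32_two_eq (a b c' d : ℤ) (v : Fin 3 → ℤ) : actInt32 a b c' d v 2 = binVal32 v b d := by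
  simp only [actInt32_two, binVal32]

section ConeLemmas

variable {p : ℕ} [hp : Fact p.Prime]

/-- `c32_ne_zero_zmod` (auxiliary). [folklore] -/
theorem c32_ne_zero_zmod (hp2 : p ≠ 2) : (32 : ZMod p) ≠ 0 := by
  have h2 := two_ne_zero_zmod (p := p) hp2
  have : (32 : ZMod p) = 2 ^ 5 := by norm_num
  rw [this]; exact pow_ne_zero _ h2

/-- **Lemma A** (unit leading coefficient): if `p ∣ n₃₂(v)`, `p ∤ v₀`, then every value of `ι₃₂(v)`
prime to `p` has Legendre symbol `(2v₀/p)` (`ι₃₂(v) ≡ (32v₀)⁻¹ ℓ²`, `32 = 2·4²`). [folklore] -/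
theorem jacobiSym_binVal32_of_not_dvd (hp2 : p ≠ 2) {v : Fin 3 → ℤ} (hn : (p : ℤ) ∣ nQ32 v)
    (hv0 : ¬ (p : ℤ) ∣ v 0) {s t : ℤ} (hval : ¬ (p : ℤ) ∣ binVal32 v s t) :
    jacobiSym (binVal32 v s t) p = jacobiSym (2 * v 0) p := by
  rw [jacobiSym_eq_quadraticChar, jacobiSym_eq_quadraticChar]
  have hnz : ((nQ32 v : ℤ) : ZMod p) = 0 := (intCast_zmod_eq_zero_iff _).mpr hn
  have hv0' : ((v 0 : ℤ) : ZMod p) ≠ 0 := fun h ↦ hv0 ((intCast_zmod_eq_zero_iff _).mp h)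
  have hval' : ((binVal32 v s t : ℤ) : ZMod p) ≠ 0 := fun h ↦ hval ((intCast_zmod_eq_zero_iff _).mp h)
  have h2 := two_ne_zero_zmod (p := p) hp2
  have key : (16 : ZMod p) * ((2 : ZMod p) * (v 0 : ℤ)) * (binVal32 v s t : ℤ) =
      ((32 * v 0 * s + 32 * v 1 * t : ℤ) : ZMod p) ^ 2 := by
    have := congrArg (fun z : ℤ ↦ (z : ZMod p)) (mul_binVal32_eq v s t)
    push_cast at this ⊢
    linear_combination this - 32 * (t : ZMod p) ^ 2 * hnz
  have h16 : (16 : ZMod p) ≠ 0 := by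
    have : (16 : ZMod p) = 2 ^ 4 := by norm_num
    rw [this]; exact pow_ne_zero _ h2
  have h2v : (2 : ZMod p) * ((v 0 : ℤ) : ZMod p) ≠ 0 := mul_ne_zero h2 hv0'
  have hL : ((32 * v 0 * s + 32 * v 1 * t : ℤ) : ZMod p) ≠ 0 := by
    intro h0
    rw [h0, zero_pow two_ne_zero] at key
    rcases mul_eq_zero.mp key with h1 | h1
    · rcases mul_eq_zero.mp h1 with h3 | h3
      · exact h16 h3
      · exact h2v h3
    · exact hval' h1
  have hsq : quadraticChar (ZMod p) (((32 * v 0 * s + 32 * v 1 * t : ℤ) : ZMod p) ^ 2) = 1 :=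
    quadraticChar_sq_one' hL
  rw [← key, map_mul, map_mul] at hsq
  have h16sq : quadraticChar (ZMod p) (16 : ZMod p) = 1 := by
    have : (16 : ZMod p) = 4 ^ 2 := by norm_num
    rw [this]
    exact quadraticChar_sq_one' (by
      intro h4
      apply h16
      have : (16 : ZMod p) = 4 * 4 := by norm_num
      rw [this, h4, mul_zero])
  rw [h16sq, one_mul] at hsq
  push_cast
  rcases quadraticChar_dichotomy h2v with h1 | h1
  · rw [h1, one_mul] at hsq; rw [hsq, h1]
  · rw [h1] at hsq ⊢
    linear_combination -hsq

/-- In the situation of Lemma A, `p ∣ ι₃₂(v)(s,t)` forces `p ∣ ℓ(s,t) = 32v₀s + 32v₁t`. [folklore] -/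
theorem dvd_lin_of_dvd_binVal32 {v : Fin 3 → ℤ} (hn : (p : ℤ) ∣ nQ32 v)
    {s t : ℤ} (hval : (p : ℤ) ∣ binVal32 v s t) : (p : ℤ) ∣ 32 * v 0 * s + 32 * v 1 * t := by
  rw [← intCast_zmod_eq_zero_iff] at hval hn ⊢
  have key : ((32 * v 0 * s + 32 * v 1 * t : ℤ) : ZMod p) ^ 2 = 0 := by
    have := congrArg (fun z : ℤ ↦ (z : ZMod p)) (mul_binVal32_eq v s t)
    push_cast at this hval hn ⊢
    rw [hval, hn] at this
    linear_combination -this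
  exact pow_eq_zero_iff two_ne_zero |>.mp key

/-- **Lemma B** (`p ∣ v₀`): then `p ∣ v₁`. [folklore] -/
theorem dvd_one_of_dvd_zero32 (hp2 : p ≠ 2) {v : Fin 3 → ℤ} (hn : (p : ℤ) ∣ nQ32 v)
    (hv0 : (p : ℤ) ∣ v 0) : (p : ℤ) ∣ v 1 := by
  rw [← intCast_zmod_eq_zero_iff] at hn hv0 ⊢
  have h32 := c32_ne_zero_zmod (p := p) hp2
  unfold nQ32 at hn
  push_cast at hn
  rw [hv0, zero_mul, sub_zero] at hn
  rcases mul_eq_zero.mp hn with h | h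
  · exact absurd h h32
  · exact pow_eq_zero_iff two_ne_zero |>.mp h

/-- `binVal32_modEq_of_dvd_zero` (auxiliary): `ι₃₂(v)(s,t) ≡ v₂ t² (mod p)` when `p ∣ v₀`. [folklore] -/
theorem binVal32_modEq_of_dvd_zero (hp2 : p ≠ 2) {v : Fin 3 → ℤ} (hn : (p : ℤ) ∣ nQ32 v)
    (hv0 : (p : ℤ) ∣ v 0) (s t : ℤ) : binVal32 v s t ≡ v 2 * t ^ 2 [ZMOD p] := by
  have hv1 := dvd_one_of_dvd_zero32 hp2 hn hv0
  unfold binVal32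
  have h1 : 32 * v 0 * s ^ 2 ≡ 0 [ZMOD p] :=
    Int.modEq_zero_iff_dvd.mpr (dvd_mul_of_dvd_left (dvd_mul_of_dvd_right hv0 _) _)
  have h2 : 64 * v 1 * s * t ≡ 0 [ZMOD p] :=
    Int.modEq_zero_iff_dvd.mpr (dvd_mul_of_dvd_left (dvd_mul_of_dvd_left
      (dvd_mul_of_dvd_right hv1 _) _) _)
  have := (h1.add h2).add (Int.ModEq.refl (v 2 * t ^ 2))
  simpa using this

/-- **`Ω_p` is `Γ₀(32)`-invariant**: `Ω_p(ι₃₂(v) ∘ g) = Ω_p(ι₃₂(v))` for `g = (a b; 32c' d) ∈ SL₂(ℤ)`,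
`p` an odd prime. [folklore] -/
theorem coneSym32_actInt32 (hp2 : p ≠ 2) {a b c' d : ℤ} (hdet : a * d - 32 * b * c' = 1)
    (v : Fin 3 → ℤ) : coneSym32 p (actInt32 a b c' d v) = coneSym32 p v := by
  unfold coneSym32
  rw [nQ32_actInt32 hdet]
  by_cases hn : (p : ℤ) ∣ nQ32 v
  swap
  · rw [if_neg hn, if_neg hn]
  rw [if_pos hn, if_pos hn]
  set v' := actInt32 a b c' d v with hv'
  have e0 : 32 * v' 0 = binVal32 v a (32 * c') := actInt32_zero_eq a b c' d v
  have e2 : v' 2 = binVal32 v b d := actInt32_two_eq a b c' d v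
  have hp' : Prime (p : ℤ) := Nat.prime_iff_prime_int.mp hp.out
  have h32p : ¬ (p : ℤ) ∣ 32 := by
    intro h
    have : ((32 : ℤ) : ZMod p) = 0 := (intCast_zmod_eq_zero_iff _).mpr h
    exact c32_ne_zero_zmod (p := p) hp2 (by exact_mod_cast this)
  have h2p : ¬ (p : ℤ) ∣ 2 := fun h ↦ h32p (dvd_trans h ⟨16, by norm_num⟩)
  have h4p : ¬ (p : ℤ) ∣ 4 := fun h ↦ h32p (dvd_trans h ⟨8, by norm_num⟩)
  -- `p ∣ v'₀ ↔ p ∣ ι₃₂(v)(a, 32c')`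
  have hdvd0 : (p : ℤ) ∣ v' 0 ↔ (p : ℤ) ∣ binVal32 v a (32 * c') := by
    rw [← e0]
    constructor
    · exact fun h ↦ dvd_mul_of_dvd_right h _
    · intro h
      exact (hp'.dvd_or_dvd h).resolve_left h32p
  -- `J(2 v'₀) = J(32 v'₀)` (`32 = 2 · 4²`)
  have hJ32 : jacobiSym (2 * v' 0) p = jacobiSym (32 * v' 0) p := by
    rw [show (32 : ℤ) * v' 0 = 2 * v' 0 * 4 ^ 2 by ring, jacobiSym_mul_sq h4p]
  by_cases hv0 : (p : ℤ) ∣ v 0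
  · -- Lemma B regime: `p ∣ v₀`, `p ∣ v₁`
    rw [if_pos hv0]
    have hmod0 : binVal32 v a (32 * c') ≡ v 2 * (32 * c') ^ 2 [ZMOD p] :=
      binVal32_modEq_of_dvd_zero hp2 hn hv0 a (32 * c')
    have hmod2 : v' 2 ≡ v 2 * d ^ 2 [ZMOD p] := by
      rw [e2]; exact binVal32_modEq_of_dvd_zero hp2 hn hv0 b d
    by_cases hv0' : (p : ℤ) ∣ v' 0
    · rw [if_pos hv0', jacobiSym.mod_left' hmod2]
      by_cases hv2 : (p : ℤ) ∣ v 2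
      · rw [jacobiSym_eq_zero_of_dvd hv2, jacobiSym_eq_zero_of_dvd (dvd_mul_of_dvd_left hv2 _)]
      · have hval := hdvd0.mp hv0'
        have h1 : (p : ℤ) ∣ v 2 * (32 * c') ^ 2 := (dvd_iff_of_modEq hmod0).mp hval
        have hc' : (p : ℤ) ∣ c' := by
          rcases hp'.dvd_or_dvd h1 with h | h
          · exact absurd h hv2
          · have h' := hp'.dvd_of_dvd_pow h
            rcases hp'.dvd_or_dvd h' with h'' | h''
            · exact absurd h'' h32p
            · exact h''
        have hd : ¬ (p : ℤ) ∣ d := by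
          intro hd
          have : (p : ℤ) ∣ a * d - 32 * b * c' :=
            dvd_sub (dvd_mul_of_dvd_right hd _) (dvd_mul_of_dvd_right hc' _)
          rw [hdet] at this
          exact hp'.not_dvd_one this
        rw [jacobiSym_mul_sq hd]
    · rw [if_neg hv0']
      have hval : ¬ (p : ℤ) ∣ binVal32 v a (32 * c') := fun h ↦ hv0' (hdvd0.mpr h)
      have h1 : ¬ (p : ℤ) ∣ v 2 * (32 * c') ^ 2 := fun h ↦ hval ((dvd_iff_of_modEq hmod0).mpr h)
      have hc32 : ¬ (p : ℤ) ∣ 32 * c' := fun h ↦ h1 (dvd_mul_of_dvd_right (dvd_pow h two_ne_zero) _)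
      rw [hJ32, e0, jacobiSym.mod_left' hmod0, jacobiSym_mul_sq hc32]
  · -- Lemma A regime
    rw [if_neg hv0]
    by_cases hv0' : (p : ℤ) ∣ v' 0
    · rw [if_pos hv0', e2]
      apply jacobiSym_binVal32_of_not_dvd hp2 hn hv0
      intro hbd
      have hL1 := dvd_lin_of_dvd_binVal32 hn (hdvd0.mp hv0')
      have hL2 := dvd_lin_of_dvd_binVal32 hn hbd
      have : (p : ℤ) ∣ d * (32 * v 0 * a + 32 * v 1 * (32 * c')) - 32 * c' * (32 * v 0 * b + 32 * v 1 * d) :=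
        dvd_sub (dvd_mul_of_dvd_right hL1 _) (dvd_mul_of_dvd_right hL2 _)
      have e : d * (32 * v 0 * a + 32 * v 1 * (32 * c')) - 32 * c' * (32 * v 0 * b + 32 * v 1 * d) =
          32 * v 0 * (a * d - 32 * b * c') := by ring
      rw [e, hdet, mul_one] at this
      rcases hp'.dvd_or_dvd this with h | h
      · exact h32p h
      · exact hv0 h
    · rw [if_neg hv0']
      have hval : ¬ (p : ℤ) ∣ binVal32 v a (32 * c') := fun h ↦ hv0' (hdvd0.mpr h)
      rw [hJ32, e0]
      exact jacobiSym_binVal32_of_not_dvd hp2 hn hv0 hval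

end ConeLemmas

/-- `32 ∣ c`, `ad - bc = 1` forces `d` odd. [folklore] -/
theorem odd_d_of_det32 {a b c' d : ℤ} (hdet : a * d - 32 * b * c' = 1) : Odd d := by
  by_contra hd
  rw [Int.not_odd_iff_even] at hd
  have : Even (a * d - 32 * b * c') := by
    apply Even.sub (hd.mul_left a)
    exact ⟨16 * b * c', by ring⟩
  rw [hdet] at this
  exact Int.not_even_one this

/-- **`ω_D` is `Γ₀(32)`-invariant** (`D` odd square-free): the `2`-adic part sees `v₂ mod 8`, and
`v'₂ = 32v₀b² + 64v₁bd + v₂d² ≡ v₂ (mod 8)` for odd `d`. [folklore] -/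
theorem genusWt32_actInt32 {D : ℕ} (hDodd : Odd D) {a b c' d : ℤ}
    (hdet : a * d - 32 * b * c' = 1) (v : Fin 3 → ℤ) :
    genusWt32 D (actInt32 a b c' d v) = genusWt32 D v := by
  unfold genusWt32
  have hd := odd_d_of_det32 hdet
  have h2 : actInt32 a b c' d v 2 ≡ v 2 [ZMOD 8] := by
    rw [actInt32_two]
    obtain ⟨k, hk⟩ := hd
    -- `k² + k` is even
    obtain ⟨m, hm⟩ : Even (k ^ 2 + k) := by
      have : k ^ 2 + k = k * (k + 1) := by ring
      rw [this]; exact Int.even_mul_succ_self k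
    refine Int.modEq_iff_dvd.mpr ⟨-(4 * v 0 * b ^ 2 + 8 * v 1 * b * d + v 2 * m), ?_⟩
    subst hk
    linear_combination (-4 * v 2) * hm
  rw [twoWt_congr D (dvd_refl 8) h2]
  congr 1
  refine Finset.prod_congr rfl fun p hp ↦ ?_
  have hpp := Nat.prime_of_mem_primeFactors hp
  haveI := Fact.mk hpp
  have hp2 : p ≠ 2 := by
    rintro rfl
    exact (Nat.not_even_iff_odd.mpr hDodd) (even_iff_two_dvd.mpr (Nat.dvd_of_mem_primeFactors hp))
  exact coneSym32_actInt32 hp2 hdet v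

/-! #### Scaling of the weight by integers -/

/-- `Ω_p(t v) = (t/p) Ω_p(v)` for a prime `p`. [folklore] -/
theorem coneSym32_smul {p : ℕ} (hp : p.Prime) (t : ℤ) (v : Fin 3 → ℤ) :
    coneSym32 p (t • v) = jacobiSym t p * coneSym32 p v := by
  haveI := Fact.mk hp
  have hp' : Prime (p : ℤ) := Nat.prime_iff_prime_int.mp hp
  unfold coneSym32
  rw [nQ32_smul]
  simp only [Pi.smul_apply, smul_eq_mul]
  by_cases ht : (p : ℤ) ∣ t
  · have hJ : jacobiSym t p = 0 := jacobiSym_eq_zero_of_dvd ht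
    rw [hJ, zero_mul]
    split_ifs with h1 h2
    · exact jacobiSym_eq_zero_of_dvd (dvd_mul_of_dvd_left ht _)
    · rw [show (2 : ℤ) * (t * v 0) = t * (2 * v 0) by ring]
      exact jacobiSym_eq_zero_of_dvd (dvd_mul_of_dvd_left ht _)
    · rfl
  · have e1 : ((p : ℤ) ∣ t ^ 2 * nQ32 v) ↔ (p : ℤ) ∣ nQ32 v := by
      constructor
      · intro h
        rcases hp'.dvd_or_dvd h with h | h
        · exact absurd (hp'.dvd_of_dvd_pow h) ht
        · exact h
      · exact fun h ↦ dvd_mul_of_dvd_right h _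
    have e2 : ((p : ℤ) ∣ t * v 0) ↔ (p : ℤ) ∣ v 0 := by
      constructor
      · intro h
        rcases hp'.dvd_or_dvd h with h | h
        · exact absurd h ht
        · exact h
      · exact fun h ↦ dvd_mul_of_dvd_right h _
    by_cases hn : (p : ℤ) ∣ nQ32 v
    · rw [if_pos (e1.mpr hn), if_pos hn]
      by_cases h0 : (p : ℤ) ∣ v 0
      · rw [if_pos (e2.mpr h0), if_pos h0, jacobiSym.mul_left]
      · rw [if_neg (mt e2.mp h0), if_neg h0, show (2 : ℤ) * (t * v 0) = t * (2 * v 0) by ring,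
          jacobiSym.mul_left]
    · rw [if_neg (mt e1.mp hn), if_neg hn, mul_zero]

/-- `twoWt` is multiplicative in `c`: `twoWt D (t c) = χ₈(t) χ₄(t)^{[D≡1(4)]} twoWt D c`. [folklore] -/
theorem twoWt_mul (D : ℕ) (t c : ℤ) :
    twoWt D (t * c) = (ZMod.χ₈ t * (if D % 4 = 1 then (ZMod.χ₄ t : ℤ) else 1)) * twoWt D c := by
  unfold twoWt
  rw [Int.cast_mul, Int.cast_mul, map_mul, map_mul]
  split_ifs <;> ring

/-- **Scaling of the weight**: `ω_D(t v) = χ₈(t) χ₄(t)^{[D≡1(4)]} (t/D) ω_D(v)` (`D` square-free). [folklore] -/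
theorem genusWt32_smul {D : ℕ} (hD : Squarefree D) (t : ℤ) (v : Fin 3 → ℤ) :
    genusWt32 D (t • v) =
      (ZMod.χ₈ t * (if D % 4 = 1 then (ZMod.χ₄ t : ℤ) else 1)) * jacobiSym t D * genusWt32 D v := by
  unfold genusWt32
  rw [Finset.prod_congr rfl fun p hp ↦ coneSym32_smul (Nat.prime_of_mem_primeFactors hp) t v,
    Finset.prod_mul_distrib, ← jacobiSym_eq_prod_primeFactors hD, Pi.smul_apply, smul_eq_mul,
    twoWt_mul]
  ring

end Literature.NumberTheory.EllipticCurves.Shintani
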